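import Summits.ResolutionOfSingularities.ResolutionOfSingularities.Theorems.PurelyInseparableDim4ResConeKTwoFiveLedgerN4
import Summits.ResolutionOfSingularities.ResolutionOfSingularities.Theorems.PurelyInseparableDim4ResConeCInfEntryOfChain
import HarnessLib
import HarnessLib.Audit.Tags

/-!
# Purely inseparable four-folds — THE K2(5) LEDGER THEOREM WITH NO RESIDUAL (K27e): K2(5) ⟺ SLICE C
# (cell `res-dim4-pi`, K2(p) lane, slices B/C; K27 packaging, unconditional form)

[OURS · counted 0 · cell `res-dim4-pi` · K2(p) lane; the lane holder's word (bus 2026-08-29 06:20:38Z: «when …WindowResidual +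
the rotation entry land, p-3 files K27e = `noAboveFloorTrap_five_iff_sliceC` WITH NO RESIDUAL»); seat res-dim4-p-3 g4.  The two
rotation residuals of K27c are discharged: `hslotT` by res-dim4-p-1 g4's `twoSlot_slotT_residual` (K27d, p702688) and `hN4` by
`cInf_slotRepresentation` (`…ResConeCInfEntryOfChain`: res-dim4-typ-1 g3's virtual window `SwapTransport.cInf_no_chain_of_entry`
over the (E0) entries `exists_cInf_virtual_entry_rel` / `…_of_rotation`).]  Nothing here proves K2(p)/K2(5),
`NoIsolatedTrap 5 5` or resolution of singularities in dimension ≥ 4 / characteristic `p` — NOT proved: the statement is an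
EQUIVALENCE between K2(5) (`NoAboveFloorTrap 5 5`) and the emptiness of SLICE C, and slice C is OPEN.  AI kernel work, weaker
than expert review.

* **`noAboveFloorTrap_five_iff_sliceC`** — `NoAboveFloorTrap 5 5 ↔` «over every field of characteristic `5` there is no
  isolated `Step0 5` chain with `x^{r₀} ∣ F₀`, above the floor, of constant shade `d ∈ {3, 4}` and `e_G ≡ 2`» — NO residual
  hypothesis.
* **`noAboveFloorTrap_five_iff_residual_two`** — the same with the K27 right-hand side.

[cite: CossartJannsenSaito2020, Thm. 3.14] [cite: Hauser2010, §§F–G] [cite: HauserPerlega2019, §1]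
bears_on: LADDER-RESOLUTION:D157-DOOR2 (res-dim4-pi · K2(p) · K27e: K2(5) ⟺ slice C, no residual).
Supports stmt-ResolutionOfSingularities-16155 (helper).
-/

set_option linter.dupNamespace false -- mandated namespace of this single-conjunct summit

noncomputable section

namespace Summit.ResolutionOfSingularities.ResolutionOfSingularities.Theorems.PIDim4

namespace ResCone

open MvPolynomial Finset
open Literature.AlgebraicGeometry.Resolution
open Literature.AlgebraicGeometry.Resolution.CentreBlowup
open Literature.AlgebraicGeometry.Resolution.Hauser2010
open Literature.AlgebraicGeometry.Resolution.HauserPerlega2019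
open RidgeBudget (NoAboveFloorTrap)

/-- **THE K2(5) LEDGER THEOREM, NO RESIDUAL (K27e): K2(5) ⟺ SLICE C** — `NoAboveFloorTrap 5 5` holds iff over every field
of characteristic `5` there is no isolated above-floor `Step0 5` chain with `x^{r₀} ∣ F₀` of constant shade `d ∈ {3, 4}` and
`e_G ≡ 2`. [OURS] [cite: CossartJannsenSaito2020, Thm. 3.14] -/
theorem noAboveFloorTrap_five_iff_sliceC :
    NoAboveFloorTrap 5 5 ↔ ∀ (K : Type) [Field K] [CharP K 5] [DecidableEq K],
      ¬ ∃ (c : ℕ → State K) (d : ℕ), 3 ≤ d ∧ d ≤ 4 ∧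
          (∀ e' ∈ (c 0).F.support, (c 0).r ≤ e') ∧
          ∀ k, IsIsolated 5 (c k).F ∧ Step0 5 (c k) (c (k + 1)) ∧ ordZero (c k).F ≠ (5 : ℕ) ∧
            (c k).shade = (d : ℕ∞) ∧ Module.finrank K (resVertex (c k)) = 2 :=
  noAboveFloorTrap_five_iff_sliceC_of_N4 cInf_slotRepresentation

/-- **K27, NO RESIDUAL**: K2(5) ⟺ (no `d = 2`, `e_G = 3` satellite tail) ∧ (no isolated binary-cone trap of shade
`2 ≤ d ≤ 4`). [OURS] [cite: CossartJannsenSaito2020, Thm. 3.14] -/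
theorem noAboveFloorTrap_five_iff_residual_two :
    NoAboveFloorTrap 5 5 ↔ ∀ (K : Type) [Field K] [CharP K 5] [DecidableEq K],
      (¬ ∃ (c : ℕ → State K) (j : ℕ → Fin 4) (b : ℕ → Fin 4 → K),
          (∀ e' ∈ (c 0).F.support, (c 0).r ≤ e') ∧ FreeTail.IsWitnessedChain 5 c j b ∧
          (∀ k, IsIsolated 5 (c k).F ∧ Step0 5 (c k) (c (k + 1)) ∧ ordZero (c k).F ≠ (5 : ℕ) ∧
            (c k).shade = ((2 : ℕ) : ℕ∞) ∧ Module.finrank K (resVertex (c k)) = 3) ∧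
          ∀ N, ∃ k, N ≤ k ∧ FreeTail.IsSatellite j b k ∧
            ordZero (c k).F = (6 : ℕ) ∧ ordZero (c (k + 1)).F = (6 : ℕ)) ∧
      (¬ ∃ (c : ℕ → State K) (d : ℕ), 2 ≤ d ∧ d ≤ 4 ∧
          (∀ e' ∈ (c 0).F.support, (c 0).r ≤ e') ∧
          ∀ k, IsIsolated 5 (c k).F ∧ Step0 5 (c k) (c (k + 1)) ∧ ordZero (c k).F ≠ (5 : ℕ) ∧
            (c k).shade = (d : ℕ∞) ∧ Module.finrank K (resVertex (c k)) = 2) :=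
  noAboveFloorTrap_five_iff_residual_two_of_N4 cInf_slotRepresentation

end ResCone

end Summit.ResolutionOfSingularities.ResolutionOfSingularities.Theorems.PIDim4

end
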